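import Summits.HodgeConjecture.CorCM.Census.TypeStabiliserIndexTwo

/-!
# The `2`-rank `d₂(G/N)` as a number, and `d₂(G/𝒦)` for the type-stabiliser subgroup

COR-CM (cell `pub-hodgecm2`), count-neutral kernel combinatorics by the census seat lit-andre-3 (gen 19; lane TYPE-STABILISER-SUBGROUP),
sequel of `Census/TypeStabiliserIndexTwo.lean` (Klein third, sign characters, `#{H : [G:H] = 2, N ≤ H} + 1 = #Hom(G/N, ℤ/2) = 2^d`) and
`Census/TypeStabiliserSubgroup.lean` (`stabGen c = 𝒦(G,c)`).  One bookkeeping definition with body (`indexTwoRank`) + theorems, everything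
proved; no `Prop`-valued definition, no certificate, no named fact, no `sorry`.  HONEST FRAMING: `HC_CM` is NOT proved; nothing here
is a period or a headline.

CONTENT.
* §5 **The number** `indexTwoRank N := log₂ (#{H : [G:H] = 2, N ≤ H} + 1)` with `two_pow_indexTwoRank : 2 ^ indexTwoRank N = #{H} + 1`
  (finite `G`, normal `N`), `card_signChar_quotient : #Hom(G/N, ℤ/2) = 2 ^ indexTwoRank N`, `indexTwoRank_eq_zero_of_forall` /
  `indexTwoRank_top` / `indexTwoRank_ne_zero`, and the linear-algebra packaging
  `finrank_addChar_quotient : Module.finrank (ZMod 2) (Additive (G ⧸ N) →+ ZMod 2) = indexTwoRank N` — so `indexTwoRank N` IS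
  `d₂(G/N) = dim_{𝔽₂} Hom(G/N, 𝔽₂)`, the `2`-rank of `(G/N)^{ab}`, in all three currencies (count, number, `finrank`).
* §6 **Over `𝒦(G,c)`** (`c` central): `two_pow_indexTwoRank_stabGen : 2 ^ d₂(G/𝒦) = #{H : [G:H] = 2, 𝒦 ≤ H} + 1`,
  `card_indexTwoOver_stabGen_le : #{H : [G:H] = 2, 𝒦 ≤ H} ≤ #{H : [G:H] = 2, c ∈ H}` (= b09ʼs `hTwo c`), `indexTwoRank_stabGen_eq_zero_of_cpl`
  (complemented `c` ⇒ `d₂ = 0`), `indexTwoRank_stabGen_eq_zero_of_forall` / `indexTwoRank_stabGen_ne_zero` (`d₂ = 0 ↔` no index-two `H ∋ c`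
  contains every `stab Ψ` — the hypothesis of b09ʼs `𝒦`-criterion, read through `stabGen_le_iff`).  With it the closed form of the
  coinvariant fibre types as `fibreTwo c + 2 = Fintype.card (Block c) + indexTwoRank (stabGen c)` (`|G|/2` even).
-/

namespace Summit.HodgeConjecture.CorCM.Census.IndexTwo

open Function

section Generic

variable {G : Type*} [Group G]

/-! ## §5 The `2`-rank over `N` as a number -/

/-- **The `2`-rank over `N`**: `d₂(G/N) := log₂ (#{H : [G:H] = 2, N ≤ H} + 1)` — by §4 the argument is a power of two, so
`2 ^ indexTwoRank N = #{H : [G:H] = 2, N ≤ H} + 1` exactly (`two_pow_indexTwoRank`); it is `dim_{𝔽₂} Hom(G/N, 𝔽₂)`. [folklore] -/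
noncomputable def indexTwoRank (N : Subgroup G) : ℕ :=
  Nat.log 2 (Nat.card {H : Subgroup G // H.index = 2 ∧ N ≤ H} + 1)

/-- **`2 ^ d₂(G/N) = #{H : [G:H] = 2, N ≤ H} + 1`** (finite `G`, normal `N`). [folklore] -/
theorem two_pow_indexTwoRank [Finite G] (N : Subgroup G) [N.Normal] :
    2 ^ indexTwoRank N = Nat.card {H : Subgroup G // H.index = 2 ∧ N ≤ H} + 1 := by
  obtain ⟨d, hd⟩ := exists_card_indexTwoOver_add_one_eq_two_pow N
  rw [indexTwoRank, hd, Nat.log_pow (by norm_num)]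

/-- **`#Hom(G/N, ℤ/2) = 2 ^ d₂(G/N)`** (finite `G`, normal `N`). [folklore] -/
theorem card_signChar_quotient [Finite G] (N : Subgroup G) [N.Normal] :
    Nat.card (G ⧸ N →* Multiplicative (ZMod 2)) = 2 ^ indexTwoRank N := by
  rw [two_pow_indexTwoRank, card_indexTwoOver_add_one]

/-- `d₂(G/N) = 0` when no index-two subgroup contains `N` (e.g. `N = ⊤`). [folklore] -/
theorem indexTwoRank_eq_zero_of_forall (N : Subgroup G) (h : ∀ H : Subgroup G, H.index = 2 → ¬ N ≤ H) :
    indexTwoRank N = 0 := by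
  haveI : IsEmpty {H : Subgroup G // H.index = 2 ∧ N ≤ H} := ⟨fun H => h H.1 H.2.1 H.2.2⟩
  rw [indexTwoRank, Nat.card_of_isEmpty, zero_add, Nat.log_one_right]

/-- `d₂(G/G) = 0`. [folklore] -/
theorem indexTwoRank_top : indexTwoRank (⊤ : Subgroup G) = 0 :=
  indexTwoRank_eq_zero_of_forall ⊤ fun H hH hle => by
    have : H = ⊤ := top_le_iff.mp hle
    rw [this, Subgroup.index_top] at hH
    exact absurd hH (by decide)

/-- Conversely, an index-two subgroup over `N` forces `d₂(G/N) ≠ 0` (finite `G`, normal `N`). [folklore] -/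
theorem indexTwoRank_ne_zero [Finite G] (N : Subgroup G) [N.Normal] {H : Subgroup G} (hH : H.index = 2) (hle : N ≤ H) :
    indexTwoRank N ≠ 0 := by
  intro h0
  have h := two_pow_indexTwoRank N
  rw [h0, pow_zero] at h
  haveI : Finite {H : Subgroup G // H.index = 2 ∧ N ≤ H} := Subtype.finite
  have hpos : 0 < Nat.card {H : Subgroup G // H.index = 2 ∧ N ≤ H} := Nat.card_pos_iff.mpr ⟨⟨⟨H, hH, hle⟩⟩, inferInstance⟩
  omega

/-- The additive characters `Additive (G ⧸ N) →+ ZMod 2` form a finite type. [folklore] -/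
instance finite_addChar_quotient [Finite G] (N : Subgroup G) [N.Normal] : Finite (Additive (G ⧸ N) →+ ZMod 2) :=
  Finite.of_equiv _ (MonoidHom.toAdditiveLeft (α := G ⧸ N) (β := ZMod 2))

/-- **`d₂(G/N) = dim_{𝔽₂} Hom(G/N, 𝔽₂)`**: the `𝔽₂`-dimension of the additive characters of `G ⧸ N` is `indexTwoRank N`
(finite `G`, normal `N`) — the `Module.finrank` packaging of §5. [folklore] -/
theorem finrank_addChar_quotient [Finite G] (N : Subgroup G) [N.Normal] :
    Module.finrank (ZMod 2) (Additive (G ⧸ N) →+ ZMod 2) = indexTwoRank N := by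
  have hcard : Nat.card (Additive (G ⧸ N) →+ ZMod 2) = 2 ^ indexTwoRank N := by
    rw [← card_signChar_quotient N]
    exact (Nat.card_congr (MonoidHom.toAdditiveLeft (α := G ⧸ N) (β := ZMod 2))).symm
  haveI : Module.Finite (ZMod 2) (Additive (G ⧸ N) →+ ZMod 2) := Module.Finite.of_finite
  have h := Module.natCard_eq_pow_finrank (K := ZMod 2) (V := Additive (G ⧸ N) →+ ZMod 2)
  rw [hcard, Nat.card_zmod] at h
  exact (Nat.pow_right_injective (le_refl 2) h).symm

end Generic

end Summit.HodgeConjecture.CorCM.Census.IndexTwo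

/-! ## §6 Over the type-stabiliser subgroup `𝒦(G,c)` -/

namespace Summit.HodgeConjecture.CorCM.Census.TypeStabiliser

open Summit.HodgeConjecture.CorCM.Census.IndexTwo
open Summit.HodgeConjecture.CorCM.Census.HalfParity

variable {G : Type*} [Group G] (c : G)

/-- **`2 ^ d₂(G/𝒦) = #{H : [G:H] = 2, 𝒦 ≤ H} + 1`** for the type-stabiliser subgroup `𝒦 = stabGen c` of a central `c` (finite `G`).
[folklore] -/
theorem two_pow_indexTwoRank_stabGen [Finite G] (hcen : ∀ x : G, x * c = c * x) :
    2 ^ indexTwoRank (stabGen c) = Nat.card {H : Subgroup G // H.index = 2 ∧ stabGen c ≤ H} + 1 := by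
  haveI := stabGen_normal c hcen
  exact two_pow_indexTwoRank (stabGen c)

/-- **`#{H : [G:H] = 2, 𝒦 ≤ H} ≤ #{H : [G:H] = 2, c ∈ H}`** — at most `h(G,c)` (b09ʼs `hTwo c`) index-two subgroups lie over `𝒦`
(finite `G`). [folklore] -/
theorem card_indexTwoOver_stabGen_le [Finite G] :
    Nat.card {H : Subgroup G // H.index = 2 ∧ stabGen c ≤ H} ≤ Nat.card {H : Subgroup G // H.index = 2 ∧ c ∈ H} :=
  card_indexTwoOver_le_of_mem (stabGen c) (self_mem_stabGen c)

/-- **Complemented `c` ⇒ `d₂(G/𝒦) = 0`** (`𝒦 = G` by `stabGen_eq_top_of_cpl`; b09ʼs DIRECT-FACTOR situation). [folklore] -/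
theorem indexTwoRank_stabGen_eq_zero_of_cpl (hc2 : c * c = 1) {A : Subgroup G} (hA : ∀ x : G, x ∈ A ↔ c * x ∉ A) :
    indexTwoRank (stabGen c) = 0 := by
  rw [stabGen_eq_top_of_cpl c hc2 hA]
  exact indexTwoRank_top

/-- `d₂(G/𝒦) = 0` as soon as no index-two subgroup containing `c` contains every stabiliser — the hypothesis of b09ʼs
`𝒦`-criterion (`HalfParityStabiliser`), read through `stabGen_le_iff`. [folklore] -/
theorem indexTwoRank_stabGen_eq_zero_of_forall [Fintype G] [DecidableEq G] (hc2 : c * c = 1) (hcen : ∀ x : G, x * c = c * x)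
    (h : ∀ H : Subgroup G, H.index = 2 → c ∈ H →
      ∃ Ψ : Summit.HodgeConjecture.CorCM.Prior.AllgGroup.RfwfAllgGroup.CMF G c, ¬ stab c Ψ ≤ H) :
    indexTwoRank (stabGen c) = 0 := by
  refine indexTwoRank_eq_zero_of_forall (stabGen c) fun H hH hle => ?_
  obtain ⟨hc, hall⟩ := (stabGen_le_iff c hc2 hcen).mp hle
  obtain ⟨Ψ, hΨ⟩ := h H hH hc
  exact hΨ (hall Ψ)

/-- Conversely an index-two `H ∋ c` containing every stabiliser gives `d₂(G/𝒦) ≠ 0` (finite `G`). [folklore] -/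
theorem indexTwoRank_stabGen_ne_zero [Fintype G] [DecidableEq G] (hc2 : c * c = 1) (hcen : ∀ x : G, x * c = c * x)
    {H : Subgroup G} (hH : H.index = 2) (hc : c ∈ H)
    (hall : ∀ Ψ : Summit.HodgeConjecture.CorCM.Prior.AllgGroup.RfwfAllgGroup.CMF G c, stab c Ψ ≤ H) :
    indexTwoRank (stabGen c) ≠ 0 := by
  haveI := stabGen_normal c hcen
  exact indexTwoRank_ne_zero (stabGen c) hH ((stabGen_le_iff c hc2 hcen).mpr ⟨hc, hall⟩)

end Summit.HodgeConjecture.CorCM.Census.TypeStabiliser
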